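import Mathlib
import HarnessLib
import HarnessLib.Audit
import Summits.AtomisticToContinuum.Statement
import Literature.MathematicalPhysics.KineticTheory.LangevinChainNESSHolds
import Summits.AtomisticToContinuum.FouriersLaw.Theorems.EmbeddedDrudeMourreNessUnique
import Summits.AtomisticToContinuum.FouriersLaw.Theorems.OddSectorIrreversibilityBoundedResponseConvergesStubPositiveConductance
import Summits.AtomisticToContinuum.FouriersLaw.Theorems.FourierGreenKuboFourierFiniteResponseOfUnique
import HarnessLib.Audit.Status.Attr

/-!
Route: PuiseuxTransferLedger

DORMANT since 2026-08-25T17:26:34Z (reconciler: no traction for 7.9 d (last activity item-evidence-added at 2026-08-17T19:19:10Z); parked, not closed — `ledger route dormant route-AtomisticToContinuum-PuiseuxTransferLedger --off` to rea) — unstaffed, not closed; items shared with open routes are served there. `ledger route dormant <id> --off` reactivates.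

# Route PuiseuxTransferLedger — Jordan pair of the linearised spatial transfer — exponentially exact
local Ohm law + series ledger give κ = 1/r; gap at nonzero frequency, continued in √ω (conforming
re-filing of PuiseuxTransfer)

X_PT (PUISEUX-TRANSFER / TWO-MODE LINE; realises idea card
AtomisticToContinuum/FouriersLaw/puiseux-splitting-twisted-spatial-transfer; D-0027 §2.1-conforming
RE-FILING of route-AtomisticToContinuum-PuiseuxTransfer, retired 2026-08-15T13:45Z `not-a-thesis`
only because its Assembly ended in the Literature constant instead of the Statement decl —
statements otherwise unchanged, and the deciding theorem `theorem closes (hU : NessUnique) (hFR :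
FiniteResponseOfUnique) (hPC : PositiveConductance) (hFP : FiniteResponseProfile) (hCI :
ContactIdentity) (hSL : SeriesLedgerGlue) (hTM : TwoModeBulk) (hNB : NonBallistic) : FouriersLaw` is
now PROVED sorry-free in the planner folder (glue.lean / GlueDev.lean, lean check rc 0, axioms
propext · Classical.choice · Quot.sound). Fix pinnedChain ω₂ lam β γ (all four > 0) and T > 0, keep
the Bonetto–Lebowitz–Rey-Bellet order of limits (δ = T_L − T_R → 0 at fixed N, then N → ∞); write
D_N for the clause-(ii) response coefficient, g_N := D_N/(N−1) for the per-bond conductance and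
θ_N(i) := lim_δ (μ_(N,T+δ/2,T−δ/2)(p_i²) − μ_(N,T,T)(p_i²))/δ for the kinetic-temperature response
profile. It suffices to show X = TwoModeBulk ∧ NonBallistic:
(TM) TwoModeBulk [crux 2]: ∃ r(T) ∈ ℝ, θ(T) ∈ [0,1), C(T), NOT depending on N, with |θ_N(i) −
θ_N(i+1) − r·g_N| ≤ C·|g_N|·(θ^i + θ^(N−2−i)) for every N and bond (i,i+1) — up to layers decaying
exponentially from the two contacts the linear-response state lies in the span of TWO N-independent
bulk modes, the thermal shift (flat, no current) and the current mode obeying the exact discrete Ohm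
law "drop r per bond per unit current": the Jordan block [[1,−r],[0,1]] of the linearised
site-to-site transfer of the equilibrium chain at its double eigenvalue 1 (energy conservation =
Noether sideways) plus an annular spectral gap θ;
(NB) NonBallistic [crux 3]: liminf_N D_N/(N−1) = 0 — the block is non-trivial (r ≠ 0; r = 0 is
exactly the ballistic harmonic member).
With the supports NessUnique, FiniteResponseOfUnique, PositiveConductance, FiniteResponseProfile,
the exact contact rows ContactIdentity γ(1/2 − θ_N(0)) = g_N = γ(θ_N(N−1) + 1/2), and the
pure-real-analysis SeriesLedgerGlue, the SERIES LEDGER R_N := (N−1)/D_N = 2/γ + Σ_bonds (θ_N(i) −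
θ_N(i+1))/g_N obeys |R_N − 2/γ − (N−1)·r| ≤ 2max(C,0)/(1−θ); D_N > 0 forces r ≥ 0, (NB) forces r ≠
0, so D_N → κ(T) := 1/r(T) ∈ (0,∞); uniqueness transfers the limits to every steady-state family,
and clause (i) is the proved fact pinnedChain_exists_isSteadyState + NessUnique.
Lean: `TwoModeBulk ∧ NonBallistic`

## Assembly
PROVED (glue.lean; GlueDev.lean rc 0, 0 sorries, axioms propext/Classical.choice/Quot.sound;
`theorem Assembly_holds : Assembly := closes` is syntactic). Given the eight hypotheses fix
parameters > 0. Clause (i): existence from the in-tree theorem pinnedChain_exists_isSteadyState (all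
N), uniqueness from NessUnique. Clause (ii): choose the canonical family μ₀ (the unique steady state
at positive temperatures, junk 0 otherwise); for T > 0 choose D_N (FiniteResponseOfUnique) and θ_N
(FiniteResponseProfile) by choice; TwoModeBulk gives (r, θ, C); for N ≥ 2 telescope θ_N(0) −
θ_N(N−1) = Σ_(k<N−1) (θ_N(k) − θ_N(k+1)) (Finset.sum_range_sub'), bound Σ_k |θ_N(k) − θ_N(k+1) − r
g_N| ≤ max(C,0)|g_N| Σ_k (θ^k + θ^(N−2−k)) ≤ 2max(C,0)|g_N|/(1−θ) (geom_sum_mul_neg +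
Finset.sum_range_reflect), insert the contact rows θ_N(0) = 1/2 − g_N/γ, θ_N(N−1) = g_N/γ − 1/2 and
divide by g_N > 0 (PositiveConductance): |R_N − 2/γ − (N−1)r| ≤ 2max(C,0)/(1−θ); SeriesLedgerGlue
with NonBallistic yields r > 0 and D_N → 1/r; set κ(T) := that limit (choice; κ := junk for T ≤ 0);
any other steady-state family has the same difference quotients for |δ| < 2T by uniqueness
(Filter.Tendsto.congr' on 𝓝[≠] 0). No Theorems file is needed; the only extra module dependency is
Literature.MathematicalPhysics.KineticTheory.LangevinChainNESSHolds (proved existence; the staffable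
route FourierGreenKubo depends on the same module).

Rationale: WHY THIS LINE. Read the chain SIDEWAYS (site index as time; Kirchgassner1982,
IoossKirchgassner2000): V′ is a bijection, so Newton's equation solved for the next site makes x ↦
x+1 a formal transfer on pair-path laws; linearised at the equilibrium law, energy conservation is
Noether's theorem sideways (J_x = J_(x+1)) and forces a DOUBLE eigenvalue 1 whose Jordan datum r is
the resistivity, so Fourier's law ⟺ r ∈ (0,∞) AND the rest of the transfer spectrum stays off an
N-independent annulus — every finite-N response is then "residue at the double point + O(θ^N)",
which at ω = 0 is exactly TwoModeBulk + the series ledger with κ := 1/r. The card's engine for the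
gap is the FREQUENCY TWIST: at temporal frequency ω ≠ 0 energy is stored locally, no spatial mode is
neutral, and the double point splits along the Puiseux series μ_± = 1 ± √(iω c_v r) + O(ω) (Kato1966
Ch. II §1: generic rank-2 Jordan block ⇒ square-root branching; the thermal diffusivity κ/c_v is the
inverse square of the Kato coefficient — Ångström's temperature-wave measurement read as
perturbation theory; DharEtAl2011 for the AC observable), to be proved THERE and continued
analytically in √ω with an N-independent radius. Imported with an explicit dictionary: kinetic
half-space theory (Milne/two-plate problems: solutions approach span(collision invariants)
exponentially — BardosCaflischNicolaenko1986, CoronGolseSulem1988, Cercignani1988 Ch. VIII §9) with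
collision invariants ↦ the (thermal, current) Jordan pair, Milne exponent ↦ −log θ, temperature-jump
coefficient ↦ contact resistance; analytic perturbation theory of non-semisimple eigenvalues
(Kato1966); spatial dynamics of lattices (IoossKirchgassner2000). Versus the open routes:
FourierGreenKubo needs infinite-volume time decay and κ = κ_GK; OddSectorIrreversibility,
BondHeatUncertainty and CurrentTiltQuench bound the response through parity / fluctuation-theorem /
quench inequalities; KineticCorner and PorousMediumCorner are regime anchors; this line asserts an
asymptotically EXACT local Ohm law with N-uniform exponential contact layers — a spectral statement
about ONE N-independent bulk object, entirely at finite N in Lean (no infinite dynamics, no LTE, no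
Green–Kubo identification); negatives index: no FouriersLaw entry at filing.

RANKED CRUXES. #2 TwoModeBulk (crux) — TWO-MODE (JORDAN) STRUCTURE OF THE LINEAR RESPONSE WITH
N-UNIFORM EXPONENTIAL CONTACT LAYERS (card items GapAtNonzeroFrequency + PuiseuxPair +
ContourAssembly read at ω = 0; shared verbatim with retired PuiseuxTransfer,
stmt-AtomisticToContinuum-4404). For pinnedChain ω₂ lam β γ (all > 0), under weak-NESS uniqueness,
along any steady-state family, for every T > 0 there are r ∈ ℝ, θ ∈ [0,1) and C (NOT depending on N)
such that for every N, every response coefficient d = D_N, every kinetic-temperature response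
profile t = θ_N (vacuous where the limits do not exist) and every bond (i, i+1): |t(i) − t(i+1) −
r·d/(N−1)| ≤ C·|d/(N−1)|·(θ^i + θ^(N−2−i)). Reading: the local bond resistance r_N(i) := (θ_N(i) −
θ_N(i+1))/g_N converges to ONE bulk resistivity r exponentially fast in the distance to the nearer
contact, uniformly in N — the finite-N signature of "isolated double eigenvalue 1 with Jordan block
[[1,−r],[0,1]] + annular spectral gap e^(−1/ℓ) = θ"; r is NOT asserted positive here (r = 0 ⟺ flat
bulk ⟺ ballistic: the harmonic member satisfies this crux with r = 0, support
HarmonicTwoModeCalibration), so all of 'normal transport' sits in NonBallistic and all of the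
MECHANISM sits here. Intended proof (layer 2, card): construct the frequency-twisted linearised
transfer 𝒯_T(ω), prove hyperbolicity of the complement of the Puiseux pair for 0 < |ω| ≤ ω₀ with ω₀
and the annulus N-independent, continue analytically in √ω to ω = 0, evaluate the two-point contact
problem by residues. Consistency check made at filing: for a scalar conserved field with gradient
macroscopic current the total current has no hydrodynamic long-time tail and linear response carries
no long-range correlation (those are O(δT²)), so macroscopic fluctuation theory predicts NO
algebraic bulk correction to r_N(i) — the residual risk is kinetic (mean-free-path spectrum) and
genuinely microscopic. [difficulty: open-problem] (why it might fail: Needs an isolated double point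
+ annular gap of the DC linearised spatial transfer: ungapped TIME dynamics may leave algebraic
corrector tails (the ω = 0 masquerade); unbounded mean free paths or slow local modes give
stretched-exponential layers; θ(T) → 1, C(T) → ∞ as T → 0.) [BardosCaflischNicolaenko1986,
CoronGolseSulem1988, Cercignani1988, Kato1966, Kirchgassner1982, IoossKirchgassner2000,
BonettoLebowitzLukkarinen2004, AokiKusnezov2001, AokiLukkarinenSpohn2006, HuveneersLukkarinen2020,
RiederLebowitzLieb1967]
#3 NonBallistic (crux) — NOT BALLISTIC (shared verbatim with stmt-AtomisticToContinuum-2192; here: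
the Jordan block is non-trivial, r ≠ 0 — the card's PuiseuxPair non-degeneracy 'the generalised
eigenvector is not an eigenvector'): under weak-NESS uniqueness, for every steady-state family of
pinnedChain ω₂ lam β γ (all > 0), T > 0 and response coefficients D_N: ∀ ε > 0 there are arbitrarily
long chains with D_N ≤ ε(N−1), i.e. the conductance G_N = D_N/(N−1) is not bounded away from 0.
NECESSARY for the conjunct (FouriersLawFor ⇒ HasBoundedResponse ⇒ G_N → 0) but far from equivalent
to it (anomalous conductors satisfy it); fails exactly at the harmonic member. In THIS route it has
a finite-size certificate form: once TwoModeBulk holds with explicit (θ, C), the ledger gives R_N ≤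
(N−1)r + 2/γ + 2C/(1−θ), so r = 0 would bound R_N for all N — ONE length N₀ with R_(N₀) =
(N₀−1)/D_(N₀) > 2/γ + 2C/(1−θ) proves it (certified bounds on a 2N₀-dimensional hypoelliptic
polynomial diffusion). [deps: TwoModeBulk] [difficulty: open-problem] (why it might fail: A hidden
odd conserved charge or a near-integrable member makes the chain a perfect conductor (r = 0: the
generalised eigenvector is a true eigenvector) — then FouriersLaw is false too; no theorem gives J_N
→ 0 for any deterministic anharmonic chain.) [Mazur1969, BonettoLebowitzReyBellet2000,
CanestrariLiveraniOlla2026, RoyDhar2008, Zotos2002]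
#9 NessUnique (support) — [shared stmt-AtomisticToContinuum-0741] UNIQUENESS OF THE WEAK STEADY
STATE for pinnedChain (all > 0), every N, T_L, T_R > 0, in the class IsSteadyState; with the PROVED
existence theorem
Literature.MathematicalPhysics.KineticTheory.HeatConduction.pinnedChain_exists_isSteadyState
(CuneoEckmannHairerReyBellet2018_pinnedChain_holds) it gives clause (i) and makes D_N, θ_N
canonical. Print: CEHR2018 Thm 2.13(1) + the Fokker–Planck identification lemma (weak stationary
probability solution ⇒ invariant). [difficulty: L] [CuneoEckmannHairerReyBellet2018, Carmona2007]
#9 FiniteResponseOfUnique (support) — [shared stmt-AtomisticToContinuum-0717] EXISTENCE OF THE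
RESPONSE COEFFICIENTS D_N(T) under weak-NESS uniqueness (differentiability at equilibrium of NESS
expectations of the polynomial currents in the bath temperatures; ReyBellet2003 Rem 4.4,
HairerMajda2009 Thm 2.3 framework, CEHR2018 Lyapunov structure). [difficulty: L] [ReyBellet2003,
HairerMajda2009, CuneoEckmannHairerReyBellet2018]
#9 PositiveConductance (support) — [shared stmt-AtomisticToContinuum-2188] D_N(T) > 0 for all N ≥ 2
under weak-NESS uniqueness (non-degenerate finite-volume Kubo variance). In the ledger it forces r ≥
0 and lets one divide by g_N. [difficulty: M] [ReyBellet2003, KunduDharNarayan2009,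
EckmannPilletReyBellet1999b]
#9 FiniteResponseProfile (support) — [shared stmt-AtomisticToContinuum-2742] EXISTENCE OF THE
KINETIC-TEMPERATURE RESPONSE PROFILE θ_N(i) = lim_δ (μ_(N,T+δ/2,T−δ/2)(p_i²) − μ_(N,T,T)(p_i²))/δ
under weak-NESS uniqueness (same Hairer–Majda/Rey-Bellet differentiability as
FiniteResponseOfUnique, for p_i²). [difficulty: L] [HairerMajda2009, ReyBellet2003,
BonettoLebowitzReyBellet2000]
#9 ContactIdentity (support) — [shared stmt-AtomisticToContinuum-4405] EXACT FIRST-ORDER CONTACT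
IDENTITIES (the boundary rows of the two-point contact problem): under weak-NESS uniqueness, along
any steady-state family, T > 0, N ≥ 2: if d is the response coefficient and a, b the
kinetic-temperature responses at the bath sites 0 and N−1, then γ(1/2 − a) = d/(N−1) = γ(b + 1/2).
Content: stationarity tested against p_0²/2, p_(N−1)²/2 and the site energies gives J = γ(T_L −
⟨p_0²⟩) = γ(⟨p_(N−1)²⟩ − T_R) and equality of all bond currents (J = totalCurrent/(N−1)), justified
in the weak class by cutoffs χ(H/R) and the exponential moments of the unique steady state (CEHR2018
Thm 2.13(2), in tree); the δ = 0 state is the product Gibbs state (⟨p_0²⟩ = T, J = 0); divide by δ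
and pass to the limit. Used in `closes` to turn the telescoped profile into the series ledger R_N =
2/γ + Σ_bonds r_N(i). [difficulty: M] [BonettoLebowitzReyBellet2000, LepriLiviPoliti2003,
CuneoEckmannHairerReyBellet2018, Dhar2008]
#9 SeriesLedgerGlue (support) — [shared stmt-AtomisticToContinuum-4406; pure real analysis, provable
now] For a real sequence D with D_N > 0 (N ≥ 2), γ > 0, r, B ∈ ℝ with |(N−1)/D_N − 2/γ − (N−1)·r| ≤
B for all N ≥ 2, and the non-ballistic property (∀ ε > 0 ∀ N₀ ∃ N ≥ N₀, D_N ≤ ε(N−1)): r > 0 and D_N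
→ 1/r. Proof: R_N := (N−1)/D_N > 0; r < 0 would make R_N → −∞; r = 0 gives R_N ≤ 2/γ + B hence D_N ≥
(N−1)/(2/γ + B), contradicting non-ballisticity with ε = 1/(2(2/γ+B)); so r > 0, R_N/(N−1) → r and
D_N = (N−1)/R_N → 1/r. It is the last hypothesis consumed by the proved `closes`. [difficulty:
provable-now] [BonettoLebowitzReyBellet2000]
#9 HarmonicTwoModeCalibration (support) — [shared stmt-AtomisticToContinuum-4407; regression test at
the integrable corner, provable from the tree; NOT a hypothesis of `closes`] For the pinned HARMONIC
chain pinnedChain ω₂ 0 0 γ (ω₂, γ > 0) there is a steady-state family (the Gaussian states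
harmonicNESS of HarmonicChainNESS.lean) along which, for every T > 0, D_N and the profiles t_N
exist, D_N > 0 for N ≥ 2, and the TwoModeBulk inequality holds WITH r = 0: |t_N(i) − t_N(i+1)| ≤
C·|D_N/(N−1)|·(θ^i + θ^(N−2−i)) with N-independent θ < 1, C — Rieder–Lebowitz–Lieb/Nakazawa: flat
bulk with geometric boundary layers (HarmonicChainFlux.lean: rootR, fluxCoeff, oddSol), while g_N =
fluxCoeff_N ≥ c > 0. The ballistic member HAS the two-mode structure with zero resistivity and
violates exactly NonBallistic: the route cannot prove too much, and the normalisations are exercised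
on a closed form. [difficulty: M] [RiederLebowitzLieb1967, Nakazawa1970, RoyDhar2008,
BonettoLebowitzReyBellet2000]
#9 ExponentiallyAffineResistance (support) — [shared stmt-AtomisticToContinuum-4408; BY-PRODUCT =
the card's finite-size law, NOT a hypothesis of `closes`] Under weak-NESS uniqueness, along any
steady-state family, T > 0: ∃ r > 0, ρ, θ ∈ [0,1), C with |(N−1)/D_N − ((N−1)r + ρ)| ≤ Cθ^N for all
N ≥ 2 — Fourier's law with contact resistances ρ = 2/γ + ρ_L + ρ_R and EXPONENTIALLY small
corrections beyond them (card item ContourAssembly: D_N by residues at the Puiseux pair + O(θ^N)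
from the gapped part). Follows from TwoModeBulk + NonBallistic + the foreseen layer-2 statement
FarContactDecoupling; filed so that refuters can test the sharp rate prediction against R_N data
(1/N corrections to D_N are then ENTIRELY contact resistance) — its refutation would not break
`closes` but would discredit the spectral-gap picture behind TwoModeBulk's exponential rate.
[difficulty: open-problem] [AokiKusnezov2001, LepriLiviPoliti2003, BonettoLebowitzLukkarinen2004]

TWO-LAYER PLAN. Foreseen glued splits (filed only in tenure, D-0019): TwoModeBulk ⇐
TwistedTransferGap → PuiseuxContinuation → TwoModeBulk, where TwistedTransferGap [needs definition
D1]: for 0 < |ω| ≤ ω₀(T) the first-order response of the N-chain to a bath-temperature modulation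
T_L(t) = T + a cos ωt decays exponentially in the site index away from the modulated contact,
uniformly in N, with two simple slowest multipliers μ_±(ω) and the rest of the spatial spectrum
inside a fixed annulus (thermal skin effect; no neutral mode at ω ≠ 0); and PuiseuxContinuation:
μ_±(ω) = 1 ± √(iω c_v(T) r(T)) + O(ω) are the two branches of one germ analytic in √ω on |ω| < ω₀
with ω₀ and the annulus N-independent and r > 0 (Kato1966 II-§1 reduction for a rank-2 Jordan block;
symplectic reciprocity μ_+μ_− = 1 + O(ω) from the sideways Lagrangian structure), residues at the
pair + contour deformation in the √ω-plane giving TwoModeBulk, FarContactDecoupling and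
ExponentiallyAffineResistance at ω = 0 for all N at once. Second foreseen split: NonBallistic ⇐
ExplicitTwoModeConstants → OneLengthCertificate → NonBallistic (TwoModeBulk with explicit θ, C at
one T, plus ONE certified N₀ with (N₀−1)/D_(N₀) > 2/γ + 2C/(1−θ)).

KILL CRITERIA. (a) ¬TwoModeBulk by a power-law approach of the local resistance r_N(i) to its
plateau (or an N-dependent plateau) at fixed T — kit NEMD on pinnedChain 1 1 1 1 makes the case, a
theorem exhibiting algebraic DC response kernels for the pinned chain closes it: close
`refuted:TwoModeBulk` unless the single allowed restatement with a summable (non-exponential) rate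
survives the same witness (same `closes`, the ledger only needs a summable layer profile); (b)
¬NonBallistic ⇒ hidden conserved quantity ⇒ file ¬FouriersLaw (pattern
HarmonicChainBallisticFlux.not_fouriersLawFor) — kills every route; (c) refutation of the by-product
ExponentiallyAffineResistance does not break `closes` (drop it) but, with (a)-type numerics, signals
that the spectral-gap picture is wrong; (d) the AC calibration: if the Bonetto–Lebowitz–Lukkarinen
self-consistent harmonic chain's frequency-twisted covariance transfer matrices show NO ±√(iω
c_v/κ_BLL) pair, the Puiseux proof strategy (layer 2) is dead and the route is closed `exhausted`
unless another engine for TwoModeBulk is named; (e) mooted (close `superseded`) if another route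
proves clause (ii) first.

NOT DECOMPOSED YET. The operator itself: the Banach/dichotomy setting for the linearised sideways
transfer 𝒯_T(ω) on first-order perturbations of the equilibrium pair-path law (ill-posed two-sided
Cauchy problem ⇒ exponential dichotomies à la Kirchgässner rather than honest spectra), its
analyticity in ω, the identification of the abstract two-point contact problem with the unique weak
NESS to first order, c_v(T) of the infinite chain, and the FarContactDecoupling statement |r_N(i) −
r_(N+1)(i)| ≤ Cθ^(N−1−i) that upgrades the ledger to ExponentiallyAffineResistance — all layer 2.
Also deliberately not decomposed: the T-dependence of (r, θ, C) (allowed to degenerate as T → 0: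
LowTemperatureWeakAnharmonicity), the choice of thermometer (any local thermometer normalised at
equilibrium has the same bulk drops in the two-mode sector; kinetic temperature is used because the
contact identities are exact for it), and the engine for NonBallistic.

CHEAPEST FALSIFIER. Nonequilibrium MD (kit) of pinnedChain 1 1 1 1 with Langevin baths, γ = 1, T =
1, δ = ±0.2 (symmetrised difference quotient), N ∈ {128, 256}: estimate g_N and the profile θ_N(i),
plot the local bond resistance r_N(i) = (θ_N(i) − θ_N(i+1))/g_N against i. TwoModeBulk predicts an
N-INDEPENDENT plateau r approached like θ^i from each contact (straight line in log scale, same θ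
for both N); a power-law approach, or plateaux differing between N = 128 and 256 beyond error bars,
kills the crux as stated. Zero-cost analytic checks already consistent: at lam = β = 0 the profile
is flat with geometric layers (Rieder–Lebowitz–Lieb; tree: HarmonicChainFlux rootR < 1) =
TwoModeBulk with r = 0; for the self-consistent harmonic chain exponential spatial kernels are a
theorem (BonettoLebowitzLukkarinen2004 Lemma 4.1). Not run here (plancard seat, no kit in payload).

NUMBERS. Harmonic corner: flat bulk, layer ratio rootR(ω₂,γ)² < 1, g_N = fluxCoeff_N → fluxLimit > 0
(tree: HarmonicChainFlux.lean). Kinetic regime (prediction, not theorem): κ ≈ C(λT)^(−2) so r(T) ≈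
(λT)²/C, mean free path ℓ₁ ~ (λT)^(−2) hence θ(T) ≳ exp(−c(λT)²), and a second phonon-number length
ℓ₂ ~ (λT)^(−2p), p ≥ 2 (HuveneersLukkarinen2020). Contact layers: temperature jumps ∝ J with
extrapolation length ~ mean free path (AokiKusnezov2001). Milne problem (hard spheres): exponential
approach e^(−σx) to span(collision invariants) (BardosCaflischNicolaenko1986; Cercignani1988 pp.
395–396). Items at open: 11 (2 cruxes, 8 support, 1 assembly); `closes` uses 8 of them.

DEFINITION REQUESTS. None needed by the filed items (all over FouriersLaw.lean vocabulary). To be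
filed for the layer-2 split of TwoModeBulk: (D1) FloquetSteadyState / AC response — time-periodic
weak steady states of the N-chain with modulated bath temperature T_L(φ) = T + a cos φ (probability
measures on PhaseSpace N × circle solving ∫ (ω ∂_φ f + L_(T_L(φ),T_R) f) dμ = 0 for smooth compactly
supported f) and their first-order (a → 0) response profiles; topic
Literature/MathematicalPhysics/KineticTheory (source DharEtAl2011 for the observable). Foreseen, not
filed: (D2) the specific heat c_v(T) of the infinite pinned chain from IsChainGibbsMeasure; (D3) the
twisted transfer 𝒯_T(ω) itself.

Novelty: Searches (2026-08-15, this seat + the retired twin + the card): `ledger negatives --problem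
AtomisticToContinuum` (6 refuted statements, none in FouriersLaw); this seat's `lit search
"temperature profile boundary layer contact resistance anharmonic chain heat bath finite-size
correction conductivity"` and `lit search "Milne problem phonon Boltzmann boundary layer temperature
jump anharmonic chain contact resistance"` both answered rc 75 (searchd unavailable 18:40Z–18:50Z,
D-0023) and are recorded as NOT run; `lit galaxy search "temperature profile anharmonic chain
boundary layer" --star all` (0/0/0 hits), `lit galaxy search "boundary resistance in anharmonic
chains" --star all` (0/0/0), `lit galaxy search "temperature jump at the boundaries" --star pdf` (1
hit, an engineering heat-transfer journal page, irrelevant); the twin seat (11:33Z) ran `lit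
frontier AtomisticToContinuum --since 2020` (30 rows; arXiv:2604.14056, arXiv:2310.13338 noted,
nothing on spatial transfer / Knudsen structure of chains), `lit bridges AtomisticToContinuum
--cross any` (30, none relevant), `lit search --hybrid "Milne problem half-space linearized
Boltzmann exponential decay collision invariants …"` (12 held books → Cercignani1988 Ch. VIII §9 pp.
395–396 read), `lit search --hybrid "temperature profile boundary layer contact resistance
finite-size corrections heat conduction anharmonic chain Langevin baths"` (12 engineering texts, 0
relevant), `lit search --source crossref "boundary temperature jump  [refs: 10.1103/physreve.83.011101, 2604.14056, 2310.13338, math-ph/0307035, cond-mat/0602082, doi:10.1103/physreve.83.011101, isbn:9780471983200, Cercignani1988, BonettoLebowitzLukkarinen2004, AokiLukkarinenSpohn2006, DharEtAl2011, Kirchgassner1982, IoossKirchgassner2000, BardosCaflischNicolaenko1986, Kato1966]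

Barriers (technique_class: spatial-transfer frequency-twist jordan-puiseux): - technique_class: spatial-transfer frequency-twist jordan-puiseux
- Literature.Barriers.AtomisticToContinuum.HasBoundedResponse: implied (not evaded) — the ledger
gives R_N ≥ (N−1)r − 2max(C,0)/(1−θ), so TwoModeBulk + NonBallistic + PositiveConductance ⇒ sup_N
D_N < ∞; the N-uniformity HBR (hasBoundedResponse_of_fouriersLawFor,
FixedLengthNoConductivityControl) demands is relocated, openly, into the N-independence of (r, θ,
C), which IS the bet.
- Literature.Barriers.AtomisticToContinuum.HarmonicChainBallisticFlux: consistent — the harmonic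
member satisfies TwoModeBulk with r = 0 (flat bulk, geometric layers; support
HarmonicTwoModeCalibration) and violates exactly NonBallistic; anharmonicity enters only through r ≠
0 and the size of θ, C.
- Literature.Barriers.AtomisticToContinuum.AjankiHuveneers2011_scaling: not applicable (no
disorder); reproduced in the card's trichotomy as "hyperbolic at a.e. frequency".
- Literature.Barriers.AtomisticToContinuum.LowTemperatureWeakAnharmonicity: nothing perturbative in
(lam, β) or uniform in T is claimed; θ(T) → 1, C(T) → ∞, r(T) → 0 as T → 0 with two kinetic lengths
(λT)^(−2) and (λT)^(−2p); by the proved conjugacy the cruxes at (T; lam, β) equal the cruxes at (1;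
lamT, βT).
- Literature.Barriers.AtomisticToContinuum.BeckerMenegaki2022_gapClosing: no temporal relaxation
rate is used; the gap is SPATIAL (annulus of the transfer spectrum) and coexists with the closing
temporal gap of the N-chain — the neutral pair at ω = 0 is the diffusi

History (route lifecycle, newest last):
- 2026-08-25T17:26:34Z · DORMANT — reconciler: no traction for 7.9 d (last activity item-evidence-added at 2026-08-17T19:19:10Z); parked, not closed — `ledger route dormant route-AtomisticToConti (operator:999:2136329)

sub-problem: FouriersLaw · status: dormant · opened planner-plancard-AtomisticToContinuum-Fourier-f2bb5456-g2-0 2026-08-15T18:49:46Z · rev 2 · ledger route-AtomisticToContinuum-PuiseuxTransferLedger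
GENERATED by the gate from the ledger (D-0016/17). Provers cite these decls: `theorem foo : Summit.AtomisticToContinuum.FouriersLaw.Theses.PuiseuxTransferLedger.<Decl> := …` in Summits/AtomisticToContinuum/FouriersLaw/Theorems/<Name>.lean.
-/

namespace Summit.AtomisticToContinuum.FouriersLaw.Theses.PuiseuxTransferLedger

open scoped BigOperators Topology Manifold Classical MeasureTheory ProbabilityTheory Matrix InnerProductSpace ComplexConjugate ContinuousMap
open Filter Set Function TopologicalSpace MeasureTheory

attribute [summit_statement] _root_.FouriersLaw

/-- item stmt-AtomisticToContinuum-12111 · crux · rank 2 · open · by planner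
why it might fail: Needs an isolated double point + annular gap of the DC linearised spatial transfer: ungapped TIME dynamics may leave algebraic corrector tails (the ω = 0 masquerade); unbounded mean free paths or slow local modes give stretched-exponential layers; θ(T) → 1, C(T) → ∞ as T → 0.
sources: BardosCaflischNicolaenko1986, CoronGolseSulem1988, Cercignani1988, Kato1966, Kirchgassner1982, IoossKirchgassner2000
[crux] TWO-MODE (JORDAN) STRUCTURE OF THE LINEAR RESPONSE WITH N-UNIFORM EXPONENTIAL CONTACT LAYERS
(card items GapAtNonzeroFrequency + PuiseuxPair + ContourAssembly read at ω = 0; shared verbatim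
with retired PuiseuxTransfer, stmt-AtomisticToContinuum-4404). For pinnedChain ω₂ lam β γ (all > 0),
under weak-NESS uniqueness, along any steady-state family, for every T > 0 there are r ∈ ℝ, θ ∈
[0,1) and C (NOT depending on N) such that for every N, every response coefficient d = D_N, every
kinetic-temperature response profile t = θ_N (vacuous where the limits do not exist) and every bond
(i, i+1): |t(i) − t(i+1) − r·d/(N−1)| ≤ C·|d/(N−1)|·(θ^i + θ^(N−2−i)). Reading: the local bond
resistance r_N(i) := (θ_N(i) − θ_N(i+1))/g_N converges to ONE bulk resistivity r exponentially fast
in the distance to the nearer contact, uniformly in N — the finite-N signature of "isolated double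
eigenvalue 1 with Jordan block [[1,−r],[0,1]] + annular spectral gap e^(−1/ℓ) = θ"; r is NOT
asserted positive here (r = 0 ⟺ flat bulk ⟺ ballistic: the harmonic member satisfies this crux with
r = 0, support HarmonicTwoModeCalibration), so all of 'normal transport' sits in NonBallistic and
all of the MECHANISM si -/
@[route_item "route-AtomisticToContinuum-PuiseuxTransferLedger", crux]
def TwoModeBulk : Prop :=
  ∀ ω₂ lam β γ : ℝ, 0 < ω₂ → 0 < lam → 0 < β → 0 < γ → (∀ (N : ℕ) (T_L T_R : ℝ), 0 < T_L → 0 < T_R → ∀ μ ν : MeasureTheory.Measure (Literature.MathematicalPhysics.KineticTheory.HeatConduction.PhaseSpace N), (Literature.MathematicalPhysics.KineticTheory.HeatConduction.pinnedChain ω₂ lam β γ).IsSteadyState N T_L T_R μ → (Literature.MathematicalPhysics.KineticTheory.HeatConduction.pinnedChain ω₂ lam β γ).IsSteadyState N T_L T_R ν → μ = ν) → ∀ μ : (N : ℕ) → ℝ → ℝ → MeasureTheory.Measure (Literature.MathematicalPhysics.KineticTheory.HeatConduction.PhaseSpace N), (∀ (N : ℕ) (T_L T_R : ℝ), 0 <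 T_L → 0 < T_R → (Literature.MathematicalPhysics.KineticTheory.HeatConduction.pinnedChain ω₂ lam β γ).IsSteadyState N T_L T_R (μ N T_L T_R)) → ∀ T : ℝ, 0 < T → ∃ r θ C : ℝ, 0 ≤ θ ∧ θ < 1 ∧ ∀ (N : ℕ) (d : ℝ) (t : Fin N → ℝ), Filter.Tendsto (fun δ : ℝ => (Literature.MathematicalPhysics.KineticTheory.HeatConduction.pinnedChain ω₂ lam β γ).totalCurrent (μ N (T + δ / 2) (T - δ / 2)) / δ) (nhdsWithin 0 {(0 : ℝ)}ᶜ) (nhds d) → (∀ i : Fin N, Filter.Tendsto (fun δ : ℝ => ((∫ x, (x.2 i) ^ 2 ∂(μ N (T + δ / 2) (T - δ / 2))) - ∫ x, (x.2 i) ^ 2 ∂(μ N T T)) / δ) (nhdsWithin 0 {(0 : ℝ)}ᶜ) (nhds (t i))) → ∀ i j : Fin N, j.val = i.val + 1 → |t i - t j - r * (d / ((N : ℝ) - 1))| ≤ C * |d / ((N : ℝ) - 1)| * (θ ^ i.val + θ ^ (N - 2 - i.val))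

/-- item stmt-AtomisticToContinuum-9127 · crux · rank 3 · open · by planner
why it might fail: A hidden odd conserved charge or a near-integrable member makes the chain a perfect conductor (r = 0: the generalised eigenvector is a true eigenvector) — then FouriersLaw is false too; no theorem gives J_N → 0 for any deterministic anharmonic chain.
sources: Mazur1969, BonettoLebowitzReyBellet2000, CanestrariLiveraniOlla2026, RoyDhar2008, Zotos2002
[support] SHARED (identical signature to SuperadditiveJunction's crux
stmt-AtomisticToContinuum-2192): under weak-NESS uniqueness, for every steady-state family, T > 0
and response coefficients D: ∀ ε > 0 there are arbitrarily long chains with D_N ≤ ε(N−1) (the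
conductance is not bounded away from 0). In THIS route it is the OUTPUT of the light-cone rung
(TransferToNonBallistic), not used by the Assembly. [difficulty: XL] -/
@[route_item "route-AtomisticToContinuum-PuiseuxTransferLedger", crux]
def NonBallistic : Prop :=
  ∀ ω₂ lam β γ : ℝ, 0 < ω₂ → 0 < lam → 0 < β → 0 < γ → (∀ (N : ℕ) (T_L T_R : ℝ), 0 < T_L → 0 < T_R → ∀ μ ν : MeasureTheory.Measure (Literature.MathematicalPhysics.KineticTheory.HeatConduction.PhaseSpace N), (Literature.MathematicalPhysics.KineticTheory.HeatConduction.pinnedChain ω₂ lam β γ).IsSteadyState N T_L T_R μ → (Literature.MathematicalPhysics.KineticTheory.HeatConduction.pinnedChain ω₂ lam β γ).IsSteadyState N T_L T_R ν → μ = ν) → ∀ μ : (N : ℕ) → ℝ → ℝ → MeasureTheory.Measure (Literature.MathematicalPhysics.KineticTheory.HeatConduction.PhaseSpace N), (∀ (N : ℕ) (T_L T_R : ℝ), 0 < T_L → 0 < T_R → (Literature.MathematicalPhysics.KineticTheory.HeatConduction.pinnedChain ω₂ lam β γ).IsSteadyState N T_L T_R (μ N T_L T_R)) → ∀ T : ℝ,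 0 < T → ∀ D : ℕ → ℝ, (∀ N : ℕ, Filter.Tendsto (fun δ : ℝ => (Literature.MathematicalPhysics.KineticTheory.HeatConduction.pinnedChain ω₂ lam β γ).totalCurrent (μ N (T + δ / 2) (T - δ / 2)) / δ) (nhdsWithin 0 {(0 : ℝ)}ᶜ) (nhds (D N))) → ∀ ε : ℝ, 0 < ε → ∀ N₀ : ℕ, ∃ N : ℕ, N₀ ≤ N ∧ D N ≤ ε * ((N : ℝ) - 1)

/-- item stmt-AtomisticToContinuum-0717 · support · rank 9 · closed · proved by Summit.AtomisticToContinuum.FouriersLaw.Theorems.FourierGreenKubo.finiteResponseOfUnique_holds (prover) · by planner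
sources: ReyBellet2003, HairerMajda2009, CuneoEckmannHairerReyBellet2018
CONDITIONAL FORM OF 0705 (supersedes it as the prover target; refuters pool-5/g3-0: 0705 stand-alone
quantifies over EVERY steady-state family and is false-prone if weak steady states were non-unique):
assuming UNIQUENESS of weak steady states (IsSteadyState class) for pinnedChain at all N, T_L, T_R >
0, the finite-N linear-response limit D_N(T) = lim_{δ→0, δ≠0} totalCurrent(μ_{N,T+δ/2,T−δ/2})/δ
exists for every T > 0 and N. Content: differentiability at equilibrium of NESS expectations of the
polynomial currents in the bath temperatures (ReyBellet2003 arXiv:math-ph/0303021 Rem 4.4 (51)–(56)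
finite-volume Green–Kubo; HairerMajda2009 arXiv:0909.4313 Thm 2.3 framework — their SDE Thm 4.4
Assumption 5 fails here, so verify Assumptions 1–3 via CEHR2018 (2.5)/Carmona2007 Thm 1.1(iv)
weighted spectral gap). N = 0, 1: totalCurrent ≡ 0, D = 0. Together with 0706 gives 0705. -/
@[route_item "route-AtomisticToContinuum-PuiseuxTransferLedger", crux]
def FiniteResponseOfUnique : Prop :=
  ∀ ω₂ lam β γ : ℝ, 0 < ω₂ → 0 < lam → 0 < β → 0 < γ → (∀ (N : ℕ) (T_L T_R : ℝ), 0 < T_L → 0 < T_R → ∀ μ ν : MeasureTheory.Measure (Literature.MathematicalPhysics.KineticTheory.HeatConduction.PhaseSpace N), (Literature.MathematicalPhysics.KineticTheory.HeatConduction.pinnedChain ω₂ lam β γ).IsSteadyState N T_L T_R μ → (Literature.MathematicalPhysics.KineticTheory.HeatConduction.pinnedChain ω₂ lam β γ).IsSteadyState N T_L T_R ν → μ = ν) → ∀ μ : (N : ℕ) → ℝ → ℝ → MeasureTheory.Measure (Literature.MathematicalPhysics.KineticTheory.HeatConduction.PhaseSpace N), (∀ (N : ℕ) (T_L T_R : ℝ),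 0 < T_L → 0 < T_R → (Literature.MathematicalPhysics.KineticTheory.HeatConduction.pinnedChain ω₂ lam β γ).IsSteadyState N T_L T_R (μ N T_L T_R)) → ∀ T : ℝ, 0 < T → ∀ N : ℕ, ∃ D : ℝ, Filter.Tendsto (fun δ : ℝ => (Literature.MathematicalPhysics.KineticTheory.HeatConduction.pinnedChain ω₂ lam β γ).totalCurrent (μ N (T + δ / 2) (T - δ / 2)) / δ) (nhdsWithin 0 {(0 : ℝ)}ᶜ) (nhds D)

/-- `FiniteResponseOfUnique` holds: proved by `Summit.AtomisticToContinuum.FouriersLaw.Theorems.FourierGreenKubo.finiteResponseOfUnique_holds`. -/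
theorem FiniteResponseOfUnique_holds : FiniteResponseOfUnique := _root_.Summit.AtomisticToContinuum.FouriersLaw.Theorems.FourierGreenKubo.finiteResponseOfUnique_holds

/-- item stmt-AtomisticToContinuum-0741 · support · rank 9 · closed · proved by Summit.AtomisticToContinuum.FouriersLaw.Theorems.nessUnique_proof (prover) · by planner
sources: CuneoEckmannHairerReyBellet2018, Carmona2007
[crux] UNIQUENESS OF THE WEAK STEADY STATE (the half of stmt-0706 not covered by the landed fact
Literature.MathematicalPhysics.KineticTheory.HeatConduction.CuneoEckmannHairerReyBellet2018_pinnedChain,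
p3544): for pinnedChain ω₂ lam β γ (all > 0), every N and T_L, T_R > 0, any two measures in the weak
Fokker–Planck class IsSteadyState (probability, ∫ L f dμ = 0 for f ∈ C_c^∞, bond currents
integrable) coincide. Print: uniqueness of the INVARIANT MEASURE of the Langevin semigroup
(CuneoEckmannHairerReyBellet2018 Thm 2.13(1): C1, C2, CA; Carmona2007 Thm 1.1(iii)); the item
additionally needs 'weak stationary probability solution of L*μ = 0 ⇒ P_t-invariant' for this
hypoelliptic L with cubic drift (Echeverría 1982 well-posed martingale problem on C_c^∞ +
non-explosion via e^{θH}; Bogachev–Krylov–Röckner–Shaposhnikov 2015 Ch. 5 is non-degenerate only) —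
the FP-identification lemma is the formal crux. N = 0: PhaseSpace 0 is a point (unique probability
measure); N = 1: both baths on site 0, OU at temperature (T_L+T_R)/2. This is exactly the hypothesis
of FiniteResponse and ThermodynamicLimit and, with the fact, gives clause (i) of FouriersLawFor. -/
@[route_item "route-AtomisticToContinuum-PuiseuxTransferLedger", crux]
def NessUnique : Prop :=
  ∀ ω₂ lam β γ : ℝ, 0 < ω₂ → 0 < lam → 0 < β → 0 < γ → ∀ (N : ℕ) (T_L T_R : ℝ), 0 < T_L → 0 < T_R → ∀ μ ν : MeasureTheory.Measure (Literature.MathematicalPhysics.KineticTheory.HeatConduction.PhaseSpace N), (Literature.MathematicalPhysics.KineticTheory.HeatConduction.pinnedChain ω₂ lam β γ).IsSteadyState N T_L T_R μ → (Literature.MathematicalPhysics.KineticTheory.HeatConduction.pinnedChain ω₂ lam β γ).IsSteadyState N T_L T_R ν → μ = ν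

/-- `NessUnique` holds: proved by `Summit.AtomisticToContinuum.FouriersLaw.Theorems.nessUnique_proof`. -/
theorem NessUnique_holds : NessUnique := _root_.Summit.AtomisticToContinuum.FouriersLaw.Theorems.nessUnique_proof

/-- item stmt-AtomisticToContinuum-11750 · support · rank 9 · closed · proved by Summit.AtomisticToContinuum.FouriersLaw.Cruxes.BoundedResponseConverges.TwoScaleGluingLogRigidity.Stubs.positiveConductance_holds (prover) · by planner
sources: ReyBellet2003, KunduDharNarayan2009, EckmannPilletReyBellet1999b
[support] POSITIVE CONDUCTANCE AT EVERY FINITE LENGTH (fixed-N analysis): under weak-NESS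
uniqueness, for every steady-state family, T > 0 and response coefficients D, D_N(T) > 0 for all N ≥
2. Content: the finite-volume Kubo / fluctuation formula D_N = (N−1)T⁻² ∫₀^∞ ⟨j_b(0) Σ_i j_i(t)⟩_eq
dt = lim_t Var(Q_t)/(2tT²) ≥ 0 (ReyBellet2003 Rem 4.4 (56); KunduDharNarayan2009 for Langevin baths)
is NON-DEGENERATE — the time-integrated boundary energy current is not an L²-coboundary of the
equilibrium dynamics; equivalently strict positivity of entropy production at T_L ≠ T_R
(EckmannPilletReyBellet1999b) survives at first order in δT. Needed so that R_N = (N−1)/D_N is a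
resistance in (A) and in the Fekete step. Fixed-N toolbox: CuneoEckmannHairerReyBellet2018 Thm 2.13,
Carmona2007, HairerMajda2009. [difficulty: M] -/
@[route_item "route-AtomisticToContinuum-PuiseuxTransferLedger", crux]
def PositiveConductance : Prop :=
  ∀ ω₂ lam β γ : ℝ, 0 < ω₂ → 0 < lam → 0 < β → 0 < γ → (∀ (N : ℕ) (T_L T_R : ℝ), 0 < T_L → 0 < T_R → ∀ μ ν : MeasureTheory.Measure (Literature.MathematicalPhysics.KineticTheory.HeatConduction.PhaseSpace N), (Literature.MathematicalPhysics.KineticTheory.HeatConduction.pinnedChain ω₂ lam β γ).IsSteadyState N T_L T_R μ → (Literature.MathematicalPhysics.KineticTheory.HeatConduction.pinnedChain ω₂ lam β γ).IsSteadyState N T_L T_R ν → μ = ν) → ∀ μ : (N : ℕ) → ℝ → ℝ → MeasureTheory.Measure (Literature.MathematicalPhysics.KineticTheory.HeatConduction.PhaseSpace N), (∀ (N : ℕ) (T_L T_R : ℝ), 0 < T_L → 0 < T_R → (Literature.MathematicalPhysics.KineticTheory.HeatConduction.pinnedChain ω₂ lam β γ).IsSteadyState N T_L T_R (μ N T_L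 T_R)) → ∀ T : ℝ, 0 < T → ∀ D : ℕ → ℝ, (∀ N : ℕ, Filter.Tendsto (fun δ : ℝ => (Literature.MathematicalPhysics.KineticTheory.HeatConduction.pinnedChain ω₂ lam β γ).totalCurrent (μ N (T + δ / 2) (T - δ / 2)) / δ) (nhdsWithin 0 {(0 : ℝ)}ᶜ) (nhds (D N))) → ∀ N : ℕ, 2 ≤ N → 0 < D N

/-- `PositiveConductance` holds: proved by `Summit.AtomisticToContinuum.FouriersLaw.Cruxes.BoundedResponseConverges.TwoScaleGluingLogRigidity.Stubs.positiveConductance_holds`. -/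
theorem PositiveConductance_holds : PositiveConductance := _root_.Summit.AtomisticToContinuum.FouriersLaw.Cruxes.BoundedResponseConverges.TwoScaleGluingLogRigidity.Stubs.positiveConductance_holds

/-- item stmt-AtomisticToContinuum-12011 · support · rank 9 · closed · proved by Summit.AtomisticToContinuum.FouriersLaw.Theorems.PuiseuxTransferLedgerFiniteResponseProfile.finiteResponseProfile_proof (prover) · by planner
sources: HairerMajda2009, ReyBellet2003, BonettoLebowitzReyBellet2000
[support] [shared, stmt-AtomisticToContinuum-2742] under weak-NESS uniqueness, for every
steady-state family, T > 0, N and site i, the profile difference quotient (μ_{N,T+δ/2,T−δ/2}(p_i²) −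
μ_{N,T,T}(p_i²))/δ has a limit θ_N(i) as δ → 0, δ ≠ 0 (same differentiability, observable p_i²;
needed to instantiate θ_N in MonotoneProfile / LocalOhm / BVProfile). [difficulty: M] -/
@[route_item "route-AtomisticToContinuum-PuiseuxTransferLedger", crux]
def FiniteResponseProfile : Prop :=
  ∀ ω₂ lam β γ : ℝ, 0 < ω₂ → 0 < lam → 0 < β → 0 < γ → (∀ (N : ℕ) (T_L T_R : ℝ), 0 < T_L → 0 < T_R → ∀ μ ν : MeasureTheory.Measure (Literature.MathematicalPhysics.KineticTheory.HeatConduction.PhaseSpace N), (Literature.MathematicalPhysics.KineticTheory.HeatConduction.pinnedChain ω₂ lam β γ).IsSteadyState N T_L T_R μ → (Literature.MathematicalPhysics.KineticTheory.HeatConduction.pinnedChain ω₂ lam β γ).IsSteadyState N T_L T_R ν → μ = ν) → ∀ μ : (N : ℕ) → ℝ → ℝ → MeasureTheory.Measure (Literature.MathematicalPhysics.KineticTheory.HeatConduction.PhaseSpace N), (∀ (N : ℕ) (T_L T_R : ℝ), 0 < T_L → 0 < T_R → (Literature.MathematicalPhysics.KineticTheory.HeatConduction.pinnedChain ω₂ lam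 β γ).IsSteadyState N T_L T_R (μ N T_L T_R)) → ∀ T : ℝ, 0 < T → ∀ (N : ℕ) (i : Fin N), ∃ t : ℝ, Filter.Tendsto (fun δ : ℝ => ((∫ x, (x.2 i) ^ 2 ∂(μ N (T + δ / 2) (T - δ / 2))) - ∫ x, (x.2 i) ^ 2 ∂(μ N T T)) / δ) (nhdsWithin 0 {(0 : ℝ)}ᶜ) (nhds t)

/-- item stmt-AtomisticToContinuum-12112 · support · rank 9 · closed · proved by Summit.AtomisticToContinuum.FouriersLaw.Theorems.contactIdentity_proof (prover) · by planner
sources: BonettoLebowitzReyBellet2000, LepriLiviPoliti2003, CuneoEckmannHairerReyBellet2018, Dhar2008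
[support] [shared stmt-AtomisticToContinuum-4405] EXACT FIRST-ORDER CONTACT IDENTITIES (the boundary
rows of the two-point contact problem): under weak-NESS uniqueness, along any steady-state family, T
> 0, N ≥ 2: if d is the response coefficient and a, b the kinetic-temperature responses at the bath
sites 0 and N−1, then γ(1/2 − a) = d/(N−1) = γ(b + 1/2). Content: stationarity tested against
p_0²/2, p_(N−1)²/2 and the site energies gives J = γ(T_L − ⟨p_0²⟩) = γ(⟨p_(N−1)²⟩ − T_R) and
equality of all bond currents (J = totalCurrent/(N−1)), justified in the weak class by cutoffs
χ(H/R) and the exponential moments of the unique steady state (CEHR2018 Thm 2.13(2), in tree); the δ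
= 0 state is the product Gibbs state (⟨p_0²⟩ = T, J = 0); divide by δ and pass to the limit. Used in
`closes` to turn the telescoped profile into the series ledger R_N = 2/γ + Σ_bonds r_N(i).
[difficulty: M] -/
@[route_item "route-AtomisticToContinuum-PuiseuxTransferLedger", crux]
def ContactIdentity : Prop :=
  ∀ ω₂ lam β γ : ℝ, 0 < ω₂ → 0 < lam → 0 < β → 0 < γ → (∀ (N : ℕ) (T_L T_R : ℝ), 0 < T_L → 0 < T_R → ∀ μ ν : MeasureTheory.Measure (Literature.MathematicalPhysics.KineticTheory.HeatConduction.PhaseSpace N), (Literature.MathematicalPhysics.KineticTheory.HeatConduction.pinnedChain ω₂ lam β γ).IsSteadyState N T_L T_R μ → (Literature.MathematicalPhysics.KineticTheory.HeatConduction.pinnedChain ω₂ lam β γ).IsSteadyState N T_L T_R ν → μ = ν) → ∀ μ : (N : ℕ) → ℝ → ℝ → MeasureTheory.Measure (Literature.MathematicalPhysics.KineticTheory.HeatConduction.PhaseSpace N), (∀ (N : ℕ) (T_L T_R : ℝ), 0 < T_L → 0 < T_R → (Literature.MathematicalPhysics.KineticTheory.HeatConduction.pinnedChain ω₂ lam β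 γ).IsSteadyState N T_L T_R (μ N T_L T_R)) → ∀ T : ℝ, 0 < T → ∀ (N : ℕ) (d a b : ℝ) (i j : Fin N), 2 ≤ N → i.val = 0 → j.val = N - 1 → Filter.Tendsto (fun δ : ℝ => (Literature.MathematicalPhysics.KineticTheory.HeatConduction.pinnedChain ω₂ lam β γ).totalCurrent (μ N (T + δ / 2) (T - δ / 2)) / δ) (nhdsWithin 0 {(0 : ℝ)}ᶜ) (nhds d) → Filter.Tendsto (fun δ : ℝ => ((∫ x, (x.2 i) ^ 2 ∂(μ N (T + δ / 2) (T - δ / 2))) - ∫ x, (x.2 i) ^ 2 ∂(μ N T T)) / δ) (nhdsWithin 0 {(0 : ℝ)}ᶜ) (nhds a) → Filter.Tendsto (fun δ : ℝ => ((∫ x, (x.2 j) ^ 2 ∂(μ N (T + δ / 2) (T - δ / 2))) - ∫ x, (x.2 j) ^ 2 ∂(μ N T T)) / δ) (nhdsWithin 0 {(0 : ℝ)}ᶜ) (nhds b) → γ * (1 / 2 - a) = d / ((N : ℝ) - 1) ∧ γ * (b + 1 / 2) = d / ((N : ℝ) - 1)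

/-- item stmt-AtomisticToContinuum-12113 · support · rank 9 · closed · proved by Summit.AtomisticToContinuum.FouriersLaw.Theorems.seriesLedgerGlue_proof (prover) · by planner
sources: BonettoLebowitzReyBellet2000
[support] [shared stmt-AtomisticToContinuum-4406; pure real analysis, provable now] For a real
sequence D with D_N > 0 (N ≥ 2), γ > 0, r, B ∈ ℝ with |(N−1)/D_N − 2/γ − (N−1)·r| ≤ B for all N ≥ 2,
and the non-ballistic property (∀ ε > 0 ∀ N₀ ∃ N ≥ N₀, D_N ≤ ε(N−1)): r > 0 and D_N → 1/r. Proof: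
R_N := (N−1)/D_N > 0; r < 0 would make R_N → −∞; r = 0 gives R_N ≤ 2/γ + B hence D_N ≥ (N−1)/(2/γ +
B), contradicting non-ballisticity with ε = 1/(2(2/γ+B)); so r > 0, R_N/(N−1) → r and D_N =
(N−1)/R_N → 1/r. It is the last hypothesis consumed by the proved `closes`. [difficulty:
provable-now] -/
@[route_item "route-AtomisticToContinuum-PuiseuxTransferLedger", crux]
def SeriesLedgerGlue : Prop :=
  ∀ (D : ℕ → ℝ) (γ r B : ℝ), 0 < γ → (∀ N : ℕ, 2 ≤ N → 0 < D N) → (∀ N : ℕ, 2 ≤ N → |((N : ℝ) - 1) / D N - 2 / γ - ((N : ℝ) - 1) * r| ≤ B) → (∀ ε : ℝ, 0 < ε → ∀ N₀ : ℕ, ∃ N : ℕ, N₀ ≤ N ∧ D N ≤ ε * ((N : ℝ) - 1)) → 0 < r ∧ Filter.Tendsto D Filter.atTop (nhds (1 / r))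

/-- item stmt-AtomisticToContinuum-12114 · support · rank 9 · closed · proved by Summit.AtomisticToContinuum.FouriersLaw.Theorems.harmonicTwoModeCalibration_proof (prover) · by planner
sources: RiederLebowitzLieb1967, Nakazawa1970, RoyDhar2008, BonettoLebowitzReyBellet2000
[support] [shared stmt-AtomisticToContinuum-4407; regression test at the integrable corner, provable
from the tree; NOT a hypothesis of `closes`] For the pinned HARMONIC chain pinnedChain ω₂ 0 0 γ (ω₂,
γ > 0) there is a steady-state family (the Gaussian states harmonicNESS of HarmonicChainNESS.lean)
along which, for every T > 0, D_N and the profiles t_N exist, D_N > 0 for N ≥ 2, and the TwoModeBulk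
inequality holds WITH r = 0: |t_N(i) − t_N(i+1)| ≤ C·|D_N/(N−1)|·(θ^i + θ^(N−2−i)) with
N-independent θ < 1, C — Rieder–Lebowitz–Lieb/Nakazawa: flat bulk with geometric boundary layers
(HarmonicChainFlux.lean: rootR, fluxCoeff, oddSol), while g_N = fluxCoeff_N ≥ c > 0. The ballistic
member HAS the two-mode structure with zero resistivity and violates exactly NonBallistic: the route
cannot prove too much, and the normalisations are exercised on a closed form. [difficulty: M] -/
@[route_item "route-AtomisticToContinuum-PuiseuxTransferLedger"]
def HarmonicTwoModeCalibration : Prop :=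
  ∀ ω₂ γ : ℝ, 0 < ω₂ → 0 < γ → ∃ μ : (N : ℕ) → ℝ → ℝ → MeasureTheory.Measure (Literature.MathematicalPhysics.KineticTheory.HeatConduction.PhaseSpace N), (∀ (N : ℕ) (T_L T_R : ℝ), 0 < T_L → 0 < T_R → (Literature.MathematicalPhysics.KineticTheory.HeatConduction.pinnedChain ω₂ 0 0 γ).IsSteadyState N T_L T_R (μ N T_L T_R)) ∧ ∀ T : ℝ, 0 < T → ∃ (D : ℕ → ℝ) (t : (N : ℕ) → Fin N → ℝ) (θ C : ℝ), 0 ≤ θ ∧ θ < 1 ∧ (∀ N : ℕ, Filter.Tendsto (fun δ : ℝ => (Literature.MathematicalPhysics.KineticTheory.HeatConduction.pinnedChain ω₂ 0 0 γ).totalCurrent (μ N (T + δ / 2) (T - δ / 2)) / δ) (nhdsWithin 0 {(0 : ℝ)}ᶜ) (nhds (D N))) ∧ (∀ (N : ℕ) (i : Fin N), Filter.Tendsto (fun δ : ℝ => ((∫ x, (x.2 i) ^ 2 ∂(μ N (T + δ / 2) (T - δ / 2))) - ∫ x, (x.2 i) ^ 2 ∂(μ N T T)) / δ) (nhdsWithin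 0 {(0 : ℝ)}ᶜ) (nhds (t N i))) ∧ (∀ N : ℕ, 2 ≤ N → 0 < D N) ∧ ∀ (N : ℕ) (i j : Fin N), j.val = i.val + 1 → |t N i - t N j| ≤ C * |D N / ((N : ℝ) - 1)| * (θ ^ i.val + θ ^ (N - 2 - i.val))

/-- item stmt-AtomisticToContinuum-12115 · support · rank 9 · open · by planner
sources: AokiKusnezov2001, LepriLiviPoliti2003, BonettoLebowitzLukkarinen2004
[support] [shared stmt-AtomisticToContinuum-4408; BY-PRODUCT = the card's finite-size law, NOT a
hypothesis of `closes`] Under weak-NESS uniqueness, along any steady-state family, T > 0: ∃ r > 0,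
ρ, θ ∈ [0,1), C with |(N−1)/D_N − ((N−1)r + ρ)| ≤ Cθ^N for all N ≥ 2 — Fourier's law with contact
resistances ρ = 2/γ + ρ_L + ρ_R and EXPONENTIALLY small corrections beyond them (card item
ContourAssembly: D_N by residues at the Puiseux pair + O(θ^N) from the gapped part). Follows from
TwoModeBulk + NonBallistic + the foreseen layer-2 statement FarContactDecoupling; filed so that
refuters can test the sharp rate prediction against R_N data (1/N corrections to D_N are then
ENTIRELY contact resistance) — its refutation would not break `closes` but would discredit the
spectral-gap picture behind TwoModeBulk's exponential rate. [difficulty: open-problem] -/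
@[route_item "route-AtomisticToContinuum-PuiseuxTransferLedger", crux]
def ExponentiallyAffineResistance : Prop :=
  ∀ ω₂ lam β γ : ℝ, 0 < ω₂ → 0 < lam → 0 < β → 0 < γ → (∀ (N : ℕ) (T_L T_R : ℝ), 0 < T_L → 0 < T_R → ∀ μ ν : MeasureTheory.Measure (Literature.MathematicalPhysics.KineticTheory.HeatConduction.PhaseSpace N), (Literature.MathematicalPhysics.KineticTheory.HeatConduction.pinnedChain ω₂ lam β γ).IsSteadyState N T_L T_R μ → (Literature.MathematicalPhysics.KineticTheory.HeatConduction.pinnedChain ω₂ lam β γ).IsSteadyState N T_L T_R ν → μ = ν) → ∀ μ : (N : ℕ) → ℝ → ℝ → MeasureTheory.Measure (Literature.MathematicalPhysics.KineticTheory.HeatConduction.PhaseSpace N), (∀ (N : ℕ) (T_L T_R : ℝ), 0 < T_L → 0 < T_R → (Literature.MathematicalPhysics.KineticTheory.HeatConduction.pinnedChain ω₂ lam β γ).IsSteadyState N T_L T_R (μ N T_L T_R)) → ∀ T : ℝ, 0 < T → ∀ D : ℕ → ℝ, (∀ N : ℕ, Filter.Tendsto (fun δ : ℝ => (Literature.MathematicalPhysics.KineticTheory.HeatConduction.pinnedChain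 ω₂ lam β γ).totalCurrent (μ N (T + δ / 2) (T - δ / 2)) / δ) (nhdsWithin 0 {(0 : ℝ)}ᶜ) (nhds (D N))) → ∃ r ρ θ C : ℝ, 0 < r ∧ 0 ≤ θ ∧ θ < 1 ∧ ∀ N : ℕ, 2 ≤ N → |((N : ℝ) - 1) / D N - (((N : ℝ) - 1) * r + ρ)| ≤ C * θ ^ N

/-- item stmt-AtomisticToContinuum-12116 · assembly · rank 1 · closed · proved by Summit.AtomisticToContinuum.FouriersLaw.Theorems.puiseuxTransferLedger_assembly_proof (prover) · by planner
sources: BonettoLebowitzReyBellet2000, CuneoEckmannHairerReyBellet2018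
[assembly] NessUnique → FiniteResponseOfUnique → PositiveConductance → FiniteResponseProfile →
ContactIdentity → SeriesLedgerGlue → TwoModeBulk → NonBallistic → FouriersLaw (the sub-problem
Statement decl `_root_.FouriersLaw`, by name) — literally the type of the proved deciding theorem
`closes`. -/
@[route_item "route-AtomisticToContinuum-PuiseuxTransferLedger"]
def Assembly : Prop :=
  NessUnique → FiniteResponseOfUnique → PositiveConductance → FiniteResponseProfile → ContactIdentity → SeriesLedgerGlue → TwoModeBulk → NonBallistic → FouriersLaw

/-! D-0027 §2.1 — DECIDING THEOREM (planner-authored via `route open/edit --closes-file`; by planner-plancard-AtomisticToContinuum-Fourier-f2bb5456-g2-0 2026-08-15T18:49:48Z):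
its hypotheses are this route's items and its conclusion the sub-problem Statement (glue_lint), and it elaborates with this file. -/

/-- D-0027 §2.1 DECIDING THEOREM of route PuiseuxTransferLedger: the eight items decide the sub-problem
Statement `FouriersLaw`. Clause (i): existence from the PROVED in-tree theorem
`pinnedChain_exists_isSteadyState` (CEHR2018 Thm 2.13, all `N`), uniqueness = `NessUnique`.
Clause (ii): along the canonical family of unique steady states, the response coefficients `D_N`
(`FiniteResponseOfUnique`), the kinetic-temperature response profile (`FiniteResponseProfile`), the
exact contact rows (`ContactIdentity`) and the two-mode bulk structure (`TwoModeBulk`) give, by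
telescoping over the bonds and a geometric sum, the series ledger
`|(N-1)/D_N - 2/γ - (N-1)·r| ≤ 2·max(C,0)/(1-θ)`; `SeriesLedgerGlue` with `PositiveConductance` and
`NonBallistic` yields `r > 0` and `D_N → 1/r =: κ(T)`; any other steady-state family has the same
difference quotients near `δ = 0` by uniqueness. -/
@[closes "route-AtomisticToContinuum-PuiseuxTransferLedger"] theorem closes (hU : NessUnique) (hFR : FiniteResponseOfUnique) (hPC : PositiveConductance)
    (hFP : FiniteResponseProfile) (hCI : ContactIdentity) (hSL : SeriesLedgerGlue)
    (hTM : TwoModeBulk) (hNB : NonBallistic) : FouriersLaw := by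
  intro ω₂ lam β γ hω hl hβ hγ
  have huniq := hU ω₂ lam β γ hω hl hβ hγ
  refine ⟨?_, ?_⟩
  · -- clause (i): existence (landed theorem) + uniqueness (item NessUnique)
    intro N T_L T_R hL hR
    obtain ⟨μ, hμ⟩ :=
      Literature.MathematicalPhysics.KineticTheory.HeatConduction.pinnedChain_exists_isSteadyState
        hω hl hβ hγ N hL hR
    exact ⟨μ, hμ, fun ν hν => huniq N T_L T_R hL hR ν μ hν hμ⟩
  · -- clause (ii)
    classical
    -- the canonical family of (unique) steady states, junk `0` at non-positive temperatures
    let μ₀ : (N : ℕ) → ℝ → ℝ →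
        MeasureTheory.Measure (Literature.MathematicalPhysics.KineticTheory.HeatConduction.PhaseSpace N) :=
      fun N T_L T_R =>
        if h : 0 < T_L ∧ 0 < T_R then
          Classical.choose
            (Literature.MathematicalPhysics.KineticTheory.HeatConduction.pinnedChain_exists_isSteadyState
              hω hl hβ hγ N h.1 h.2)
        else 0
    have hμ₀ : ∀ (N : ℕ) (T_L T_R : ℝ), 0 < T_L → 0 < T_R →
        (Literature.MathematicalPhysics.KineticTheory.HeatConduction.pinnedChain ω₂ lam β γ).IsSteadyState
          N T_L T_R (μ₀ N T_L T_R) := by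
      intro N T_L T_R hL hR
      have h : 0 < T_L ∧ 0 < T_R := ⟨hL, hR⟩
      simp only [μ₀, dif_pos h]
      exact Classical.choose_spec
        (Literature.MathematicalPhysics.KineticTheory.HeatConduction.pinnedChain_exists_isSteadyState
          hω hl hβ hγ N hL hR)
    -- KEY: for every T > 0 the canonical response coefficients converge to a positive limit
    have key : ∀ T : ℝ, 0 < T → ∃ k : ℝ, 0 < k ∧ ∃ D : ℕ → ℝ,
        (∀ N : ℕ, Filter.Tendsto
          (fun δ : ℝ =>
            (Literature.MathematicalPhysics.KineticTheory.HeatConduction.pinnedChain ω₂ lam β γ).totalCurrent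
              (μ₀ N (T + δ / 2) (T - δ / 2)) / δ)
          (nhdsWithin 0 {(0 : ℝ)}ᶜ) (nhds (D N))) ∧
        Filter.Tendsto D Filter.atTop (nhds k) := by
      intro T hT
      have hD' := hFR ω₂ lam β γ hω hl hβ hγ huniq μ₀ hμ₀ T hT
      choose D hD using hD'
      have ht' := hFP ω₂ lam β γ hω hl hβ hγ huniq μ₀ hμ₀ T hT
      choose t ht using ht'
      have hpos : ∀ N : ℕ, 2 ≤ N → 0 < D N := hPC ω₂ lam β γ hω hl hβ hγ huniq μ₀ hμ₀ T hT D hD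
      obtain ⟨r, θ, C, hθ0, hθ1, hbulk⟩ := hTM ω₂ lam β γ hω hl hβ hγ huniq μ₀ hμ₀ T hT
      have hnb := hNB ω₂ lam β γ hω hl hβ hγ huniq μ₀ hμ₀ T hT D hD
      have hγ0 : γ ≠ 0 := ne_of_gt hγ
      have h1θ : 0 < 1 - θ := sub_pos.mpr hθ1
      -- the series ledger: |R_N - 2/γ - (N-1) r| ≤ B, B := 2 max(C,0)/(1-θ)
      have hledger : ∀ N : ℕ, 2 ≤ N →
          |((N : ℝ) - 1) / D N - 2 / γ - ((N : ℝ) - 1) * r| ≤ 2 * max C 0 / (1 - θ) := by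
        intro N hN
        have hN2 : (2 : ℝ) ≤ (N : ℝ) := by exact_mod_cast hN
        have hNpos : (0 : ℝ) < (N : ℝ) - 1 := by linarith
        have hN0 : (N : ℝ) - 1 ≠ 0 := ne_of_gt hNpos
        have hDpos : 0 < D N := hpos N hN
        have hD0 : D N ≠ 0 := ne_of_gt hDpos
        have hg : 0 < D N / ((N : ℝ) - 1) := div_pos hDpos hNpos
        -- the two bath sites
        have hlt0 : 0 < N := by omega
        have hltL : N - 1 < N := by omega
        obtain ⟨hc0, hcL⟩ := hCI ω₂ lam β γ hω hl hβ hγ huniq μ₀ hμ₀ T hT N (D N) (t N ⟨0, hlt0⟩)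
          (t N ⟨N - 1, hltL⟩) ⟨0, hlt0⟩ ⟨N - 1, hltL⟩ hN rfl rfl (hD N) (ht N ⟨0, hlt0⟩) (ht N ⟨N - 1, hltL⟩)
        have hbN := hbulk N (D N) (t N) (hD N) (fun i => ht N i)
        -- telescoping sequence over the sites 0, …, N-1
        let s : ℕ → ℝ := fun k => if hk : k < N then t N ⟨k, hk⟩ else 0
        have hs0 : s 0 = t N ⟨0, hlt0⟩ := dif_pos hlt0
        have hsL : s (N - 1) = t N ⟨N - 1, hltL⟩ := dif_pos hltL
        have hstep : ∀ k ∈ Finset.range (N - 1),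
            |s k - s (k + 1) - r * (D N / ((N : ℝ) - 1))| ≤
              max C 0 * |D N / ((N : ℝ) - 1)| * (θ ^ k + θ ^ (N - 2 - k)) := by
          intro k hk
          rw [Finset.mem_range] at hk
          have hk1 : k < N := by omega
          have hk2 : k + 1 < N := by omega
          have h1 : s k = t N ⟨k, hk1⟩ := dif_pos hk1
          have h2 : s (k + 1) = t N ⟨k + 1, hk2⟩ := dif_pos hk2
          rw [h1, h2]
          calc |t N ⟨k, hk1⟩ - t N ⟨k + 1, hk2⟩ - r * (D N / ((N : ℝ) - 1))|
              ≤ C * |D N / ((N : ℝ) - 1)| * (θ ^ k + θ ^ (N - 2 - k)) := hbN ⟨k, hk1⟩ ⟨k + 1, hk2⟩ rfl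
            _ ≤ max C 0 * |D N / ((N : ℝ) - 1)| * (θ ^ k + θ ^ (N - 2 - k)) := by
              apply mul_le_mul_of_nonneg_right
              · exact mul_le_mul_of_nonneg_right (le_max_left _ _) (abs_nonneg _)
              · positivity
        have htel : ∑ k ∈ Finset.range (N - 1), (s k - s (k + 1)) = s 0 - s (N - 1) :=
          Finset.sum_range_sub' s (N - 1)
        -- geometric bound, uniform in N
        have hgeom1 : ∑ k ∈ Finset.range (N - 1), θ ^ k ≤ 1 / (1 - θ) := by
          rw [le_div_iff₀ h1θ, geom_sum_mul_neg]
          have : 0 ≤ θ ^ (N - 1) := pow_nonneg hθ0 _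
          linarith
        have hrefl : ∑ k ∈ Finset.range (N - 1), θ ^ (N - 2 - k) = ∑ k ∈ Finset.range (N - 1), θ ^ k := by
          rw [← Finset.sum_range_reflect (fun k => θ ^ k) (N - 1)]
          refine Finset.sum_congr rfl fun k _ => ?_
          congr 1
        have hgeom : ∑ k ∈ Finset.range (N - 1), (θ ^ k + θ ^ (N - 2 - k)) ≤ 2 / (1 - θ) := by
          rw [Finset.sum_add_distrib, hrefl]
          have h2 : (2 : ℝ) / (1 - θ) = 1 / (1 - θ) + 1 / (1 - θ) := by ring
          rw [h2]
          exact add_le_add hgeom1 hgeom1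
        -- the telescoped estimate
        have hcard : ((Finset.range (N - 1)).card : ℝ) = (N : ℝ) - 1 := by
          rw [Finset.card_range, Nat.cast_sub (by omega : 1 ≤ N), Nat.cast_one]
        have hE : |t N ⟨0, hlt0⟩ - t N ⟨N - 1, hltL⟩ - ((N : ℝ) - 1) * (r * (D N / ((N : ℝ) - 1)))| ≤
            max C 0 * |D N / ((N : ℝ) - 1)| * (2 / (1 - θ)) := by
          have hrepr : t N ⟨0, hlt0⟩ - t N ⟨N - 1, hltL⟩ - ((N : ℝ) - 1) * (r * (D N / ((N : ℝ) - 1))) =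
              ∑ k ∈ Finset.range (N - 1), (s k - s (k + 1) - r * (D N / ((N : ℝ) - 1))) := by
            rw [Finset.sum_sub_distrib, htel, hs0, hsL, Finset.sum_const, nsmul_eq_mul, hcard]
          rw [hrepr]
          calc |∑ k ∈ Finset.range (N - 1), (s k - s (k + 1) - r * (D N / ((N : ℝ) - 1)))|
              ≤ ∑ k ∈ Finset.range (N - 1), |s k - s (k + 1) - r * (D N / ((N : ℝ) - 1))| :=
                Finset.abs_sum_le_sum_abs _ _
            _ ≤ ∑ k ∈ Finset.range (N - 1), max C 0 * |D N / ((N : ℝ) - 1)| * (θ ^ k + θ ^ (N - 2 - k)) :=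
                Finset.sum_le_sum hstep
            _ = max C 0 * |D N / ((N : ℝ) - 1)| * ∑ k ∈ Finset.range (N - 1), (θ ^ k + θ ^ (N - 2 - k)) := by
                rw [Finset.mul_sum]
            _ ≤ max C 0 * |D N / ((N : ℝ) - 1)| * (2 / (1 - θ)) := by
                apply mul_le_mul_of_nonneg_left hgeom
                exact mul_nonneg (le_max_right _ _) (abs_nonneg _)
        -- contact rows: t(0) = 1/2 - g/γ, t(N-1) = g/γ - 1/2
        have ht0 : t N ⟨0, hlt0⟩ = 1 / 2 - D N / ((N : ℝ) - 1) / γ := by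
          rw [← hc0]; field_simp; ring
        have htL : t N ⟨N - 1, hltL⟩ = D N / ((N : ℝ) - 1) / γ - 1 / 2 := by
          rw [← hcL]; field_simp; ring
        have hX : ((N : ℝ) - 1) / D N - 2 / γ - ((N : ℝ) - 1) * r =
            (t N ⟨0, hlt0⟩ - t N ⟨N - 1, hltL⟩ - ((N : ℝ) - 1) * (r * (D N / ((N : ℝ) - 1)))) / (D N / ((N : ℝ) - 1)) := by
          rw [ht0, htL]
          field_simp
          ring
        rw [hX, abs_div, abs_of_pos hg, div_le_iff₀ hg]
        calc |t N ⟨0, hlt0⟩ - t N ⟨N - 1, hltL⟩ - ((N : ℝ) - 1) * (r * (D N / ((N : ℝ) - 1)))|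
            ≤ max C 0 * |D N / ((N : ℝ) - 1)| * (2 / (1 - θ)) := hE
          _ = 2 * max C 0 / (1 - θ) * (D N / ((N : ℝ) - 1)) := by
            rw [abs_of_pos hg]; ring
      obtain ⟨hr, hlim⟩ := hSL D γ r (2 * max C 0 / (1 - θ)) hγ hpos hledger hnb
      exact ⟨1 / r, by positivity, D, hD, hlim⟩
    choose! κ hκ using key
    refine ⟨κ, fun T hT => (hκ T hT).1, ?_⟩
    intro μ hμ T hT
    obtain ⟨D, hD, hlim⟩ := (hκ T hT).2
    refine ⟨D, fun N => ?_, hlim⟩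
    -- transfer to the given family: same states near δ = 0 by uniqueness
    have hnear : ∀ᶠ δ in nhds (0 : ℝ), 0 < T + δ / 2 ∧ 0 < T - δ / 2 := by
      have hmem : Set.Ioo (-(2 * T)) (2 * T) ∈ nhds (0 : ℝ) := Ioo_mem_nhds (by linarith) (by linarith)
      filter_upwards [hmem] with δ hδ
      obtain ⟨h1, h2⟩ := hδ
      constructor <;> linarith
    refine (hD N).congr' ?_
    filter_upwards [eventually_nhdsWithin_of_eventually_nhds hnear] with δ hδ
    rw [huniq N _ _ hδ.1 hδ.2 (μ₀ N (T + δ / 2) (T - δ / 2)) (μ N (T + δ / 2) (T - δ / 2))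
      (hμ₀ N _ _ hδ.1 hδ.2) (hμ N _ _ hδ.1 hδ.2)]

end Summit.AtomisticToContinuum.FouriersLaw.Theses.PuiseuxTransferLedger
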